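import Summits.ValiantsHypothesis.ValiantsHypothesis.Theorems.RigidityForcesSymmetryGrenetFirstOrderRankRigidDesignEval

/-!
# Route RigidityForcesSymmetry — `GrenetFirstOrderRankRigid` (item stmt-ValiantsHypothesis-21029),
line `grenet_gauge`: stub `stub_linearRigid`, step 5 (block I>, part 1) — evaluating the path matrix
at a 0/1 point with DOMINATED extra cells ("sweeps")

For the crux line `Cruxes/GrenetFirstOrderRankRigid/Lines/grenet_gauge.lean` (blueprint
`Lines/grenet_gauge-stub_linearRigid-PROOF.md`, §5, block type I>; interface
`Lines/grenet_gauge-stub_linearRigid-BLOCKS.md`).  In the blocks with an OVERLAP (`|U| > |T|`: types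
I> and II) every monomial of the block identity has TWO cells in each overlap column, so the block
identity cannot be read off at column-design points (`…DesignEval`, one cell per column).  This file
evaluates the lattice-path matrix `W = adj(1 - adj)` of Grenet's branching program at an ARBITRARY 0/1
point `x_v := [P v]` (`P` a decidable predicate on the cells) along a SWEEP `δ : Fin n → Fin n`
(column `c` ↦ the row `δ c` of its PRIMARY cell), provided every other ("secondary") cell of the point
is DOMINATED:

* `forward_sweep_eq` / `evalSweep_grenet_W_empty` — if every secondary cell `(p, c)`, `c < |S|`, with
  `p ∈ S` has its row already swept (`p = δ c'` for some `c' < c`), then the paths `∅ → S` surviving at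
  the point are the same as at the column-design point of `δ`: `eval (W ∅ S) = [δ injective on the
  levels `< |S|` with image `S`]` (a surviving path that first leaves the sweep at level `c` through a
  secondary cell `(p, c)` has already inserted `p = δ c'` at the level `c' < c`);
* `backward_sweep_eq` / `evalSweep_grenet_W_univ` — dually, if every secondary cell `(p, c)`,
  `c ≥ |T₀|`, with `p ∉ T₀` has `p = δ c'` for some `c' > c`, then
  `eval (W T₀ univ) = [δ injective on the levels `≥ |T₀|` and avoids `T₀` there]`.

These generalise `evalDesign_grenet_W_empty` / `evalDesign_grenet_W_univ` (no secondary cells) and are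
consumed by the overlap designs of `…OverlapDesign` (block I>).  No new definitions.  VP ≠ VNP is not
moved by this file (first-order bookkeeping about one matrix family).
-/

noncomputable section

open MvPolynomial Matrix Finset

namespace Summit.ValiantsHypothesis.Theorems.RigidityForcesSymmetry.GrenetGauge

open Literature.Computability.AlgebraicComplexity

section SweepEval

variable (k : Type*) [CommRing k] {n : ℕ} (P : Fin n × Fin n → Prop) [DecidablePred P]

/-- An arc weight at the 0/1 point of a cell predicate: `wt j c ↦ [P (j, c)]`. [cite: Grenet2011, Thm. 1] -/
theorem evalPred_grenet_wt (j : Fin n) {c : ℕ} (hc : c < n) :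
    eval (fun v : Fin n × Fin n => if P v then (1 : k) else 0) (Grenet.wt k n j c)
      = if P (j, ⟨c, hc⟩) then 1 else 0 := by
  rw [eval_grenet_wt, dif_pos hc]

omit [DecidablePred P] in
/-- **Forward sweep.**  If every cell `(p, c)` of the point with `c < m`, `p ∈ S` and `p ≠ δ c` is
dominated (`p = δ c'` for some `c' < c`), then an injective level sequence `g : Fin m → S` all of whose
cells `(g t, s + t)`... (here `s = 0`) lie in the point IS the sweep: `g t = δ t`.  (Take the least level
`t` where `g` leaves the sweep; the row `g t = δ c'`, `c' < t`, was already used: `g c' = δ c'`.)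
[folklore] -/
theorem forward_sweep_eq (δ : Fin n → Fin n) (S : Finset (Fin n)) {m : ℕ} (hm : m ≤ n)
    (hdom : ∀ p c : Fin n, (c : ℕ) < m → P (p, c) → p ∈ S → p ≠ δ c →
      ∃ c' : Fin n, (c' : ℕ) < (c : ℕ) ∧ δ c' = p)
    (g : Fin m → Fin n) (hg : Function.Injective g) (hgS : ∀ t, g t ∈ S)
    (hgP : ∀ t : Fin m, P (g t, ⟨0 + (t : ℕ), by omega⟩)) :
    ∀ t : Fin m, g t = δ ⟨0 + (t : ℕ), by omega⟩ := by
  by_contra h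
  simp only [not_forall] at h
  obtain ⟨t, ht⟩ := h
  set s : Finset (Fin m) := univ.filter fun t => g t ≠ δ ⟨0 + (t : ℕ), by omega⟩ with hs
  have hne : s.Nonempty := ⟨t, by rw [hs, Finset.mem_filter]; exact ⟨Finset.mem_univ _, ht⟩⟩
  have ht₀ : g (s.min' hne) ≠ δ ⟨0 + ((s.min' hne : Fin m) : ℕ), by omega⟩ :=
    (Finset.mem_filter.mp (s.min'_mem hne)).2
  obtain ⟨c', hc'lt, hc'⟩ := hdom (g (s.min' hne)) ⟨0 + ((s.min' hne : Fin m) : ℕ), by omega⟩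
    (by simp) (hgP _) (hgS _) ht₀
  simp only [zero_add] at hc'lt
  have hc'm : (c' : ℕ) < m := by have := (s.min' hne).isLt; omega
  have ht₁ : g ⟨(c' : ℕ), hc'm⟩ = δ ⟨0 + (((⟨(c' : ℕ), hc'm⟩ : Fin m)) : ℕ), by omega⟩ := by
    by_contra hne1
    have hle := s.min'_le ⟨(c' : ℕ), hc'm⟩ (Finset.mem_filter.mpr ⟨Finset.mem_univ _, hne1⟩)
    rw [Fin.le_iff_val_le_val] at hle
    simp only at hle
    omega
  have hc'eq : (⟨0 + (((⟨(c' : ℕ), hc'm⟩ : Fin m)) : ℕ), by omega⟩ : Fin n) = c' := Fin.ext (by simp)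
  rw [hc'eq, hc'] at ht₁
  have hv := congrArg Fin.val (hg ht₁)
  simp only at hv
  omega

omit [DecidablePred P] in
/-- **Backward sweep.**  Dually: if every cell `(p, c)` of the point with `c ≥ |T₀|`, `p ∉ T₀` and
`p ≠ δ c` satisfies `p = δ c'` for some `c' > c`, then an injective level sequence
`g : Fin (n - |T₀|) → T₀ᶜ` whose cells `(g t, |T₀| + t)` lie in the point is the sweep:
`g t = δ (|T₀| + t)` (take the LARGEST deviating level). [folklore] -/
theorem backward_sweep_eq (δ : Fin n → Fin n) (T₀ : Finset (Fin n)) {m : ℕ} (hm : T₀.card + m = n)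
    (hdom : ∀ p c : Fin n, T₀.card ≤ (c : ℕ) → P (p, c) → p ∉ T₀ → p ≠ δ c →
      ∃ c' : Fin n, (c : ℕ) < (c' : ℕ) ∧ δ c' = p)
    (g : Fin m → Fin n) (hg : Function.Injective g) (hgT : ∀ t, g t ∉ T₀)
    (hgP : ∀ t : Fin m, P (g t, ⟨T₀.card + (t : ℕ), by omega⟩)) :
    ∀ t : Fin m, g t = δ ⟨T₀.card + (t : ℕ), by omega⟩ := by
  by_contra h
  simp only [not_forall] at h
  obtain ⟨t, ht⟩ := h
  set s : Finset (Fin m) := univ.filter fun t => g t ≠ δ ⟨T₀.card + (t : ℕ), by omega⟩ with hs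
  have hne : s.Nonempty := ⟨t, by rw [hs, Finset.mem_filter]; exact ⟨Finset.mem_univ _, ht⟩⟩
  have ht₀ : g (s.max' hne) ≠ δ ⟨T₀.card + ((s.max' hne : Fin m) : ℕ), by omega⟩ :=
    (Finset.mem_filter.mp (s.max'_mem hne)).2
  obtain ⟨c', hc'lt, hc'⟩ := hdom (g (s.max' hne)) ⟨T₀.card + ((s.max' hne : Fin m) : ℕ), by omega⟩
    (by simp) (hgP _) (hgT _) ht₀
  simp only at hc'lt
  have hc'm : (c' : ℕ) - T₀.card < m := by have := c'.isLt; omega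
  have ht₁ : g ⟨(c' : ℕ) - T₀.card, hc'm⟩
      = δ ⟨T₀.card + (((⟨(c' : ℕ) - T₀.card, hc'm⟩ : Fin m)) : ℕ), by omega⟩ := by
    by_contra hne1
    have hle := s.le_max' ⟨(c' : ℕ) - T₀.card, hc'm⟩ (Finset.mem_filter.mpr ⟨Finset.mem_univ _, hne1⟩)
    rw [Fin.le_iff_val_le_val] at hle
    simp only at hle
    omega
  have hc'eq : (⟨T₀.card + (((⟨(c' : ℕ) - T₀.card, hc'm⟩ : Fin m)) : ℕ), by omega⟩ : Fin n) = c' :=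
    Fin.ext (by simp only; omega)
  rw [hc'eq, hc'] at ht₁
  have hv := congrArg Fin.val (hg ht₁)
  simp only at hv
  omega

/-- **The source column of the path matrix along a forward sweep.**  At the 0/1 point `x_v := [P v]`,
if the primary cells `(δ c, c)`, `c < |S|`, lie in the point and every other cell `(p, c)` of the point
with `c < |S|`, `p ∈ S` is dominated (`p = δ c'`, `c' < c`), then
`eval (W ∅ S) = [δ injective on the levels < |S| with image S]` — the secondary cells carry no path
from `∅`. [folklore] -/
theorem evalSweep_grenet_W_empty (δ : Fin n → Fin n) (S : Finset (Fin n))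
    (hprim : ∀ c : Fin n, (c : ℕ) < S.card → P (δ c, c))
    (hdom : ∀ p c : Fin n, (c : ℕ) < S.card → P (p, c) → p ∈ S → p ≠ δ c →
      ∃ c' : Fin n, (c' : ℕ) < (c : ℕ) ∧ δ c' = p) :
    eval (fun v : Fin n × Fin n => if P v then (1 : k) else 0) ((1 - Grenet.adj k n).adjugate ∅ S) =
      if (∀ c c' : Fin n, (c : ℕ) < S.card → (c' : ℕ) < S.card → δ c = δ c' → c = c') ∧
          (univ.filter fun c : Fin n => (c : ℕ) < S.card).image δ = S
      then 1 else 0 := by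
  have hSn : S.card ≤ n := (Finset.card_le_univ S).trans_eq (Fintype.card_fin n)
  rw [Grenet.adjugate_one_sub (Grenet.wt k n) (grenet_adj_shape k n), Matrix.sum_apply, map_sum,
    Finset.sum_eq_single_of_mem S.card (Finset.mem_range.mpr (by omega))]
  · -- the term `m = |S|`
    rw [eval_grenet_adj_pow]
    set g₀ : Fin S.card → Fin n := fun t => δ ⟨0 + (t : ℕ), by omega⟩ with hg₀
    have h1 : ∀ (g : Fin S.card → Fin n) (t : Fin S.card),
        eval (fun v : Fin n × Fin n => if P v then (1 : k) else 0)
          (Grenet.wt k n (g t) ((∅ : Finset (Fin n)).card + t))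
          = if P (g t, ⟨0 + (t : ℕ), by omega⟩) then 1 else 0 := fun g t => by
      rw [evalPred_grenet_wt k P (g t) (by rw [Finset.card_empty]; omega)]
      congr 2
    rw [Finset.sum_eq_single_of_mem g₀ (Finset.mem_univ _)]
    · -- the sweep itself
      have hP0 : ∀ t : Fin S.card, P (g₀ t, ⟨0 + (t : ℕ), by omega⟩) := fun t => by
        rw [hg₀]
        exact hprim _ (by simp)
      have hprod : ∏ t : Fin S.card, eval (fun v : Fin n × Fin n => if P v then (1 : k) else 0)
          (Grenet.wt k n (g₀ t) ((∅ : Finset (Fin n)).card + t)) = 1 :=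
        Finset.prod_eq_one fun t _ => by rw [h1 g₀ t, if_pos (hP0 t)]
      have hempty : ∀ t : Fin S.card, g₀ t ∉ (∅ : Finset (Fin n)) := fun t => Finset.notMem_empty _
      have himg : univ.image g₀ = (univ.filter fun c : Fin n => (c : ℕ) < S.card).image δ := by
        have := image_levels_eq δ (s := 0) (m := S.card) (by omega)
        rw [hg₀, this]
        congr 1
        ext c
        simp
      have hinj : Function.Injective g₀ ↔
          ∀ c c' : Fin n, (c : ℕ) < S.card → (c' : ℕ) < S.card → δ c = δ c' → c = c' := by
        rw [hg₀, injective_levels_iff δ (s := 0) (m := S.card) (by omega)]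
        constructor
        · intro h c c' hc hc' hcc
          exact h c c' (Nat.zero_le _) (by omega) (Nat.zero_le _) (by omega) hcc
        · intro h c c' _ hc _ hc' hcc
          exact h c c' (by omega) (by omega) hcc
      by_cases hc : (∀ c c' : Fin n, (c : ℕ) < S.card → (c' : ℕ) < S.card → δ c = δ c' → c = c') ∧
          (univ.filter fun c : Fin n => (c : ℕ) < S.card).image δ = S
      · rw [if_pos hc, if_pos ⟨hinj.mpr hc.1, hempty, by rw [Finset.empty_union, himg]; exact hc.2⟩,
          hprod]
      · rw [if_neg hc, if_neg]
        rintro ⟨h1', -, h3⟩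
        rw [Finset.empty_union, himg] at h3
        exact hc ⟨hinj.mp h1', h3⟩
    · -- every other level sequence leaves the sweep and dies
      intro g _ hg
      by_cases hc : Function.Injective g ∧ (∀ t, g t ∉ (∅ : Finset (Fin n))) ∧ ∅ ∪ univ.image g = S
      · rw [if_pos hc]
        by_contra hne0
        apply hg
        funext t
        have hgS : ∀ t, g t ∈ S := fun t => by
          rw [← hc.2.2, Finset.empty_union]
          exact Finset.mem_image_of_mem g (Finset.mem_univ t)
        have hP : ∀ t : Fin S.card, P (g t, ⟨0 + (t : ℕ), by omega⟩) := fun t => by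
          by_contra hnt
          exact hne0 (Finset.prod_eq_zero (Finset.mem_univ t) (by rw [h1 g t, if_neg hnt]))
        rw [hg₀]
        exact forward_sweep_eq P δ S hSn hdom g hc.1 hgS hP t
      · rw [if_neg hc]
  · -- the other powers of `adj` have no path `∅ → S`
    intro m _ hne
    rw [eval_grenet_adj_pow]
    refine Finset.sum_eq_zero fun g _ => if_neg ?_
    rintro ⟨hg, hgS, hST⟩
    have h := card_eq_of_pathCondition hg hgS hST
    rw [Finset.card_empty, zero_add] at h
    exact hne h.symm

/-- **The sink row of the path matrix along a backward sweep.**  At the 0/1 point `x_v := [P v]`, if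
the primary cells `(δ c, c)`, `c ≥ |T₀|`, lie in the point and every other cell `(p, c)` of the point
with `c ≥ |T₀|`, `p ∉ T₀` is dominated from above (`p = δ c'`, `c' > c`), then
`eval (W T₀ univ) = [δ injective on the levels ≥ |T₀| and avoiding T₀ there]`. [folklore] -/
theorem evalSweep_grenet_W_univ (δ : Fin n → Fin n) (T₀ : Finset (Fin n))
    (hprim : ∀ c : Fin n, T₀.card ≤ (c : ℕ) → P (δ c, c))
    (hdom : ∀ p c : Fin n, T₀.card ≤ (c : ℕ) → P (p, c) → p ∉ T₀ → p ≠ δ c →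
      ∃ c' : Fin n, (c : ℕ) < (c' : ℕ) ∧ δ c' = p) :
    eval (fun v : Fin n × Fin n => if P v then (1 : k) else 0) ((1 - Grenet.adj k n).adjugate T₀ univ) =
      if (∀ c c' : Fin n, T₀.card ≤ (c : ℕ) → T₀.card ≤ (c' : ℕ) → δ c = δ c' → c = c') ∧
          (∀ c : Fin n, T₀.card ≤ (c : ℕ) → δ c ∉ T₀)
      then 1 else 0 := by
  have hTn : T₀.card ≤ n := (Finset.card_le_univ T₀).trans_eq (Fintype.card_fin n)
  rw [Grenet.adjugate_one_sub (Grenet.wt k n) (grenet_adj_shape k n), Matrix.sum_apply, map_sum,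
    Finset.sum_eq_single_of_mem (n - T₀.card) (Finset.mem_range.mpr (by omega))]
  · rw [eval_grenet_adj_pow]
    set g₀ : Fin (n - T₀.card) → Fin n := fun t => δ ⟨T₀.card + (t : ℕ), by omega⟩ with hg₀
    have h1 : ∀ (g : Fin (n - T₀.card) → Fin n) (t : Fin (n - T₀.card)),
        eval (fun v : Fin n × Fin n => if P v then (1 : k) else 0) (Grenet.wt k n (g t) (T₀.card + t))
          = if P (g t, ⟨T₀.card + (t : ℕ), by omega⟩) then 1 else 0 := fun g t =>
      evalPred_grenet_wt k P (g t) (by omega)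
    rw [Finset.sum_eq_single_of_mem g₀ (Finset.mem_univ _)]
    · have hP0 : ∀ t : Fin (n - T₀.card), P (g₀ t, ⟨T₀.card + (t : ℕ), by omega⟩) := fun t => by
        rw [hg₀]
        exact hprim _ (by simp)
      have hprod : ∏ t : Fin (n - T₀.card), eval (fun v : Fin n × Fin n => if P v then (1 : k) else 0)
          (Grenet.wt k n (g₀ t) (T₀.card + t)) = 1 :=
        Finset.prod_eq_one fun t _ => by rw [h1 g₀ t, if_pos (hP0 t)]
      have hlt : ∀ c : Fin n, (c : ℕ) < T₀.card + (n - T₀.card) := fun c => by have := c.isLt; omega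
      have himg : univ.image g₀ = (univ.filter fun c : Fin n => T₀.card ≤ (c : ℕ)).image δ := by
        have := image_levels_eq δ (s := T₀.card) (m := n - T₀.card) (by omega)
        rw [hg₀, this]
        congr 1
        exact Finset.filter_congr fun c _ => ⟨fun h' => h'.1, fun h' => ⟨h', hlt c⟩⟩
      have hinj : Function.Injective g₀ ↔
          ∀ c c' : Fin n, T₀.card ≤ (c : ℕ) → T₀.card ≤ (c' : ℕ) → δ c = δ c' → c = c' := by
        rw [hg₀, injective_levels_iff δ (s := T₀.card) (m := n - T₀.card) (by omega)]
        constructor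
        · intro h c c' hc hc' hcc
          exact h c c' hc (hlt c) hc' (hlt c') hcc
        · intro h c c' hc _ hc' _ hcc
          exact h c c' hc hc' hcc
      have havoid : (∀ t : Fin (n - T₀.card), g₀ t ∉ T₀) ↔ ∀ c : Fin n, T₀.card ≤ (c : ℕ) → δ c ∉ T₀ := by
        rw [hg₀]
        have := forall_levels_iff (fun c => δ c ∉ T₀) (s := T₀.card) (m := n - T₀.card) (by omega)
        rw [this]
        constructor
        · intro h c hc
          exact h c hc (hlt c)
        · intro h c hc _
          exact h c hc
      by_cases hc : (∀ c c' : Fin n, T₀.card ≤ (c : ℕ) → T₀.card ≤ (c' : ℕ) → δ c = δ c' → c = c') ∧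
          (∀ c : Fin n, T₀.card ≤ (c : ℕ) → δ c ∉ T₀)
      · have hdisj : Disjoint T₀ ((univ.filter fun c : Fin n => T₀.card ≤ (c : ℕ)).image δ) :=
          Finset.disjoint_left.mpr fun x hxT hx => by
            obtain ⟨c, hc', rfl⟩ := Finset.mem_image.mp hx
            exact hc.2 c (Finset.mem_filter.mp hc').2 hxT
        have huniv : T₀ ∪ univ.image g₀ = univ := by
          rw [himg]
          apply Finset.eq_univ_of_card
          rw [Finset.card_union_of_disjoint hdisj, Finset.card_image_of_injOn fun c hc₁ c' hc₁' hcc =>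
              hc.1 c c' (Finset.mem_filter.mp (Finset.mem_coe.mp hc₁)).2
                (Finset.mem_filter.mp (Finset.mem_coe.mp hc₁')).2 hcc,
            card_filter_card_le, Fintype.card_fin]
          omega
        rw [if_pos hc, if_pos ⟨hinj.mpr hc.1, havoid.mpr hc.2, huniv⟩, hprod]
      · rw [if_neg hc, if_neg]
        rintro ⟨h1', h2, -⟩
        exact hc ⟨hinj.mp h1', havoid.mp h2⟩
    · intro g _ hg
      by_cases hc : Function.Injective g ∧ (∀ t, g t ∉ T₀) ∧ T₀ ∪ univ.image g = univ
      · rw [if_pos hc]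
        by_contra hne0
        apply hg
        funext t
        have hP : ∀ t : Fin (n - T₀.card), P (g t, ⟨T₀.card + (t : ℕ), by omega⟩) := fun t => by
          by_contra hnt
          exact hne0 (Finset.prod_eq_zero (Finset.mem_univ t) (by rw [h1 g t, if_neg hnt]))
        rw [hg₀]
        exact backward_sweep_eq P δ T₀ (m := n - T₀.card) (by omega) hdom g hc.1 hc.2.1 hP t
      · rw [if_neg hc]
  · intro m _ hne
    rw [eval_grenet_adj_pow]
    refine Finset.sum_eq_zero fun g _ => if_neg ?_
    rintro ⟨hg, hgS, hST⟩
    have h := card_eq_of_pathCondition hg hgS hST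
    rw [Finset.card_univ, Fintype.card_fin] at h
    exact hne (by omega)

end SweepEval

end Summit.ValiantsHypothesis.Theorems.RigidityForcesSymmetry.GrenetGauge
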